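import Literature.MathematicalPhysics.QuantumLattice.HubbardNNNHoppingTorusLimitCorrelatorAffine
import HarnessLib

/-!
# The STATIONARITY ROW as a named thermodynamic-limit theorem: `|S|⁻¹ Σ_γ Re ω_γ(Γ [H^{1,t',U}_{Λ'}, Γ(incl) B]) = 0` for every window
# word `B ∈ 𝔄_Λ` (`thicken Λ 1 ⊆ Λ'`) and every torus-limit ground state `ω` — the equation-of-motion family of a window certificate is
# sound ON ITS OWN (both signs), extracted from the tree's certificate soundness theorem by the trivial one-row certificate

HONEST FRAMING: soundness plumbing (a consequence of the Literature theorem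
`IsTorusLimitOf.re_sum_expect_d4_ge_of_window_certificate_TT'_affine`, applied to the certificate whose only family is ONE eom word);
no number, no claim node, nothing about any material; CONTROL/CALIBRATION context (wording (xx1)); no summit statement is proved by this
file. Seat hubbard-obs-p2 (STIFFNESS), `prover-hubbard-obs-p2-g22-0`, zero compute.

WHY IT IS TYPED. The pinned-PAIR claim-node shape of record (`Downfold/TPrimePinnedPairRow.lean`, hubbard-cov-la214-unc-2:
`SquareTTPrimePinnedPairRowT`) posits two state functionals `E₀, E₁` with (E) `E₀ ω + s·E₁ ω = 0` for ground states at hopping `s` — the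
equation-of-motion penalty of the shared multipliers, split by `H_{s} = H₀ + s·T′`. Clause (E) is exactly the stationarity row below with
`B := Σ_k m_k B_k`; so a future kernel form of the pair shape (two exported vertex certificates ⇒ the pair row) takes (E) from here and
(V_A), (V_B) from `Rows/CorrWindowCertKernelForm.lean` with the eom words moved into the objective. This file is that first brick:

* `orbitMean_re_commutator_ge_zero` — one sign, straight from the Literature theorem with the one-word eom family;
* `orbitMean_re_commutator_eq_zero` — both signs: the `S`-orbit mean of `Re ω_{γΛ'}(Γ(d4Emb γ 0)(H_{Λ'} Γ B − Γ B H_{Λ'}))` VANISHES for every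
  torus limit `ω` of unit sector ground states of `hubbardTorusTT' L 1 tp U` (`U ≥ 0`, density `0 ≤ n < 2`), every label set `S ∋ 1` closed
  under products;
* `re_expect_commutator_eq_zero` — `S = {1}`: `Re ω_{Λ'}(H_{Λ'} Γ B − Γ B H_{Λ'}) = 0`.

References: X. Han, arXiv:2006.06002 §3 (stationarity constraints `⟨[H, O]⟩ = 0`) [Han2020Bootstrap]; J. Wang et al., PRX 14 (2024) 031006
§III [WangEtAl2024].
-/

noncomputable section

namespace Summit.Ventures.CertifiedManyBodySolver

namespace CARPolyWindow

open Literature.MathematicalPhysics.QuantumLattice Literature.MathematicalPhysics.QuantumLattice.HubbardWave0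
open Literature.MathematicalPhysics.QuantumManyBody.StateRelaxation
open Literature.Probability.LatticeModels ThermodynamicLimit Filter Topology
open Matrix
open scoped ComplexOrder BigOperators

/-- **One sign of the stationarity row**: `0 ≤ |S|⁻¹ Σ_γ Re ω_{γΛ'}(Γ(d4Emb γ 0)(H_{Λ'} Γ B − Γ B H_{Λ'}))` for every window word `B ∈ 𝔄_Λ`
and every torus-limit ground state — the Literature certificate theorem applied to the certificate with objective `[H_{Λ'}, Γ B]`, ONE eom
word `B`, and every other family empty. [cite: Han2020Bootstrap, §3] -/
theorem orbitMean_re_commutator_ge_zero (tp : ℝ) {U : ℝ} (hU : 0 ≤ U) {n : ℝ} (hn0 : 0 ≤ n) (hn2 : n < 2)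
    {Λ Λ' : Finset (Site 2)} (hΛ : Λ ⊆ Λ') (h8 : thicken Λ 1 ⊆ Λ')
    (h0 : thicken ({0} : Finset (Site 2)) 1 ⊆ Λ') (hz : (0 : Site 2) ∈ Λ')
    {S : Finset (DihedralGroup 4)} (h1 : (1 : DihedralGroup 4) ∈ S) (hmul : ∀ a ∈ S, ∀ b ∈ S, a * b ∈ S)
    (B : FermionOp Λ)
    {Ls : ℕ → ℕ} (hLs : Tendsto Ls atTop atTop) {ψ : ∀ L, Fock (Orb (FermionTorus 2 L))}
    (hψ : ∀ j, IsGroundStateInSector (hubbardTorusTT' (Ls j) 1 tp U) (rectN n (Ls j)) 0 (ψ (Ls j)))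
    (hψ1 : ∀ j, star (ψ (Ls j)) ⬝ᵥ ψ (Ls j) = 1) {ω : InfVolFermionState 2} (hω : ω.IsTorusLimitOf ψ Ls) :
    0 ≤ (S.card : ℝ)⁻¹ * ∑ g ∈ S, (ω.expect (d4ShiftSet g 0 Λ') (fermionEmbed (PolySite.d4Emb g 0 Λ')
      ((hubbardTTPrimeFermionInteraction 1 tp U).localHamiltonian Λ' * fermionEmbed (PolySite.incl hΛ) B -
        fermionEmbed (PolySite.incl hΛ) B * (hubbardTTPrimeFermionInteraction 1 tp U).localHamiltonian Λ'))).re := by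
  set Xw : FermionOp Λ' := (hubbardTTPrimeFermionInteraction 1 tp U).localHamiltonian Λ' * fermionEmbed (PolySite.incl hΛ) B -
    fermionEmbed (PolySite.incl hΛ) B * (hubbardTTPrimeFermionInteraction 1 tp U).localHamiltonian Λ' with hXw
  -- the trivial certificate: `Xw − 0 − 0 − 0 = 0 + (Σ_{Unit} [H, Γ B] + 0 + 0) + (0 + 0)`, every other family EMPTY
  have h := hω.re_sum_expect_d4_ge_of_window_certificate_TT'_affine (c := (0 : ℝ)) 1 tp hU hn0 hn2 0 0 hΛ h8 h0 hz h1 hmul Xw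
    (fun _ => 0) 0 Matrix.PosSemidef.zero (fun i : Fin 0 => i.elim0) (Finset.univ : Finset Unit) (fun _ => B) (∅ : Finset (Fin 0))
    (fun _ => (1 : DihedralGroup 4)) (fun l hl => absurd hl (Finset.notMem_empty l)) (fun _ => (0 : Site 2))
    (fun l : Fin 0 => l.elim0) (fun l => l.elim0) (∅ : Finset (Fin 0)) (fun _ => (0 : ℂ)) (fun j => j.elim0)
    (fun j hj => absurd hj (Finset.notMem_empty j)) (∅ : Finset (Fin 0)) (fun _ => (0 : ℝ)) (fun m => m.elim0) (∅ : Finset (Fin 0))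
    (fun _ => (0 : ℂ)) (fun k => k.elim0)
    (by
      simp only [gramForm, Finset.univ_eq_empty, Finset.sum_empty, Finset.univ_unique, Finset.sum_singleton, Complex.ofReal_zero,
        zero_smul, sub_zero, Finset.sum_const_zero, zero_add, add_zero, hXw])
    hLs hψ hψ1
  simpa using h

/-- **THE STATIONARITY ROW (both signs)**: the `S`-orbit mean of `Re ω_{γΛ'}(Γ(d4Emb γ 0)(H^{1,tp,U}_{Λ'} Γ B − Γ B H_{Λ'}))` VANISHES for
every window word `B ∈ 𝔄_Λ` (`thicken Λ 1 ⊆ Λ'`) and every torus limit of unit sector ground states — the eom constraint family of a window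
certificate is sound on its own. [cite: Han2020Bootstrap, §3] -/
theorem orbitMean_re_commutator_eq_zero (tp : ℝ) {U : ℝ} (hU : 0 ≤ U) {n : ℝ} (hn0 : 0 ≤ n) (hn2 : n < 2)
    {Λ Λ' : Finset (Site 2)} (hΛ : Λ ⊆ Λ') (h8 : thicken Λ 1 ⊆ Λ')
    (h0 : thicken ({0} : Finset (Site 2)) 1 ⊆ Λ') (hz : (0 : Site 2) ∈ Λ')
    {S : Finset (DihedralGroup 4)} (h1 : (1 : DihedralGroup 4) ∈ S) (hmul : ∀ a ∈ S, ∀ b ∈ S, a * b ∈ S)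
    (B : FermionOp Λ)
    {Ls : ℕ → ℕ} (hLs : Tendsto Ls atTop atTop) {ψ : ∀ L, Fock (Orb (FermionTorus 2 L))}
    (hψ : ∀ j, IsGroundStateInSector (hubbardTorusTT' (Ls j) 1 tp U) (rectN n (Ls j)) 0 (ψ (Ls j)))
    (hψ1 : ∀ j, star (ψ (Ls j)) ⬝ᵥ ψ (Ls j) = 1) {ω : InfVolFermionState 2} (hω : ω.IsTorusLimitOf ψ Ls) :
    (S.card : ℝ)⁻¹ * ∑ g ∈ S, (ω.expect (d4ShiftSet g 0 Λ') (fermionEmbed (PolySite.d4Emb g 0 Λ')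
      ((hubbardTTPrimeFermionInteraction 1 tp U).localHamiltonian Λ' * fermionEmbed (PolySite.incl hΛ) B -
        fermionEmbed (PolySite.incl hΛ) B * (hubbardTTPrimeFermionInteraction 1 tp U).localHamiltonian Λ'))).re = 0 := by
  have hp := orbitMean_re_commutator_ge_zero tp hU hn0 hn2 hΛ h8 h0 hz h1 hmul B hLs hψ hψ1 hω
  have hn := orbitMean_re_commutator_ge_zero tp hU hn0 hn2 hΛ h8 h0 hz h1 hmul (-B) hLs hψ hψ1 hω
  have hneg : ∀ g ∈ S, (ω.expect (d4ShiftSet g 0 Λ') (fermionEmbed (PolySite.d4Emb g 0 Λ')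
      ((hubbardTTPrimeFermionInteraction 1 tp U).localHamiltonian Λ' * fermionEmbed (PolySite.incl hΛ) (-B) -
        fermionEmbed (PolySite.incl hΛ) (-B) * (hubbardTTPrimeFermionInteraction 1 tp U).localHamiltonian Λ'))).re =
      -(ω.expect (d4ShiftSet g 0 Λ') (fermionEmbed (PolySite.d4Emb g 0 Λ')
      ((hubbardTTPrimeFermionInteraction 1 tp U).localHamiltonian Λ' * fermionEmbed (PolySite.incl hΛ) B -
        fermionEmbed (PolySite.incl hΛ) B * (hubbardTTPrimeFermionInteraction 1 tp U).localHamiltonian Λ'))).re := by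
    intro g _
    set HΛ : FermionOp Λ' := (hubbardTTPrimeFermionInteraction 1 tp U).localHamiltonian Λ' with hHΛ
    set ΓB : FermionOp Λ' := fermionEmbed (PolySite.incl hΛ) B with hΓB
    rw [map_neg, ← hΓB, mul_neg, neg_mul, show -(HΛ * ΓB) - -(ΓB * HΛ) = -(HΛ * ΓB - ΓB * HΛ) by abel, map_neg, map_neg,
      Complex.neg_re]
  rw [Finset.sum_congr rfl hneg, Finset.sum_neg_distrib, mul_neg] at hn
  linarith

/-- **Translation-only form** (`S = {1}`): `Re ω_{Λ'}(H_{Λ'} Γ B − Γ B H_{Λ'}) = 0` for every window word `B ∈ 𝔄_Λ` and every torus-limit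
ground state. [cite: Han2020Bootstrap, §3] -/
theorem re_expect_commutator_eq_zero (tp : ℝ) {U : ℝ} (hU : 0 ≤ U) {n : ℝ} (hn0 : 0 ≤ n) (hn2 : n < 2)
    {Λ Λ' : Finset (Site 2)} (hΛ : Λ ⊆ Λ') (h8 : thicken Λ 1 ⊆ Λ')
    (h0 : thicken ({0} : Finset (Site 2)) 1 ⊆ Λ') (hz : (0 : Site 2) ∈ Λ') (B : FermionOp Λ)
    {Ls : ℕ → ℕ} (hLs : Tendsto Ls atTop atTop) {ψ : ∀ L, Fock (Orb (FermionTorus 2 L))}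
    (hψ : ∀ j, IsGroundStateInSector (hubbardTorusTT' (Ls j) 1 tp U) (rectN n (Ls j)) 0 (ψ (Ls j)))
    (hψ1 : ∀ j, star (ψ (Ls j)) ⬝ᵥ ψ (Ls j) = 1) {ω : InfVolFermionState 2} (hω : ω.IsTorusLimitOf ψ Ls) :
    (ω.expect Λ' ((hubbardTTPrimeFermionInteraction 1 tp U).localHamiltonian Λ' * fermionEmbed (PolySite.incl hΛ) B -
        fermionEmbed (PolySite.incl hΛ) B * (hubbardTTPrimeFermionInteraction 1 tp U).localHamiltonian Λ')).re = 0 := by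
  have h1 : (1 : DihedralGroup 4) ∈ ({1} : Finset (DihedralGroup 4)) := Finset.mem_singleton_self 1
  have hmul : ∀ a ∈ ({1} : Finset (DihedralGroup 4)), ∀ b ∈ ({1} : Finset (DihedralGroup 4)),
      a * b ∈ ({1} : Finset (DihedralGroup 4)) := by
    intro a ha b hb
    rw [Finset.mem_singleton] at ha hb ⊢
    rw [ha, hb, mul_one]
  have h := orbitMean_re_commutator_eq_zero tp hU hn0 hn2 hΛ h8 h0 hz h1 hmul B hLs hψ hψ1 hω
  rwa [Finset.sum_singleton, Finset.card_singleton, Nat.cast_one, inv_one, one_mul,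
    ω.expect_fermionEmbed_d4Emb_one_zero] at h

end CARPolyWindow

end Summit.Ventures.CertifiedManyBodySolver

end
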